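import Summits.QuantumFields.YangMills.Theorems.AlphaInputsT3ACv3StencilGauge
import HarnessLib

/-!
# `AlphaInputsT3ACv3StencilGaugeSet` — (r1-σ)(σ-B′): the stencil gauge of `…StencilGauge` in the SET currency of its consumer (★w4 g2 `…NewtonLiftFramedLinearisation`:
# `N : Set (Site P 0)`, hypotheses `∀ b, b.src ∈ N → b.tgt ∈ N → ‖U^σ(b) − 1‖ ≤ η`): the region `anchoredUnion y T = ⋃_i [y, y + T_i]` as a set of sites, and ★★ `norm_gaugeAct_axialT_sub_one_le_of_mem`:
# from `dist1 ≤ δ` on the plaquettes with lower and upper corner in `anchoredUnion y T`, EVERY bond with both endpoints in it has `‖U^{axialT U y}(b) − 1‖ ≤ S·δ` (`S ≥ Σ_κ T_i κ` for all `i`)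
# — cell `ym3-torus`, width seat `ym-ust-19936-w2` (g2)

WHY.  `…StencilGauge` concludes bond by bond from integer side data; the consumer quantifies over a site set.  The two agree because anchored boxes are DOWN-CLOSED: a bond∕plaquette with its far
corner in `[y, y + T_i]` and its near corner anywhere in the union lies in `[y, y + T_i]` entirely (no wrap-around under the margin `2·T_i κ + 4 ≤ sitesPerDir`, `B10Eq27TorusAxialLog.rel_shift_of_le`).
WHAT.  def `anchoredUnion y T : Set (Site P j)`; `mem_anchoredUnion`; `rel_shift_of_mem` (no wrap for members); `dist1_gaugeAct_axialT_le_of_mem` (any `GaugeGroup`, `≤ S·δ`); ★★ `norm_gaugeAct_axialT_sub_one_le_of_mem`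
(`SU(n)`, operator norm); `exists_flat_gauge_on_anchoredUnion` (the `∃ σ` packaging: `σ = axialT U y`).
HONEST FRAMING.  Bookkeeping over `…StencilGauge`; count-neutral helper toward the (FL) row of 2′∕2′χ (`--supports stmt-QuantumFields-19936`); which `(y, T)` describe `(stencil of c) ∩ Ω_fine` is the
chart's ((S5)); (FL)∕`hLift`, the stub, the crux and the gap are NOT claimed; registry untouched.  YM₃ on the three-torus is RUNG R3 of the programme, not the Clay problem.

References: T. Bałaban, Commun. Math. Phys. 98 (1985) 17–51 [Balaban1985Averaging] ((8) p.18, pp.24–25); Commun. Math. Phys. 99 (1985) 75–102 [Balaban1985RegularSpaces] (Lemma 1 (1.25) p.79).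
-/

set_option autoImplicit false

noncomputable section

open scoped Matrix.Norms.L2Operator

namespace Summit.QuantumFields.YangMills.Theorems.StencilGauge

open Literature.MathematicalPhysics.QuantumFieldTheory.Balaban1983to89
open B10Eq27TorusAxialLog (axialT gaugeActT rel rel_shift_of_le)
open B7Prop1Explicit (l1 e e_apply)

variable {P : Params} {j : ℕ}

/-! ## §1 The region as a set of sites -/

/-- **THE ANCHORED UNION** `⋃_i [y, y + T_i]` as a set of torus sites (relative coordinates `rel y x ∈ [0, T_i]` for some `i`). [folklore] -/
def anchoredUnion (y : Site P j) {m : ℕ} (T : Fin m → Fin P.d → ℤ) : Set (Site P j) :=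
  {x | ∃ i, ∀ κ, 0 ≤ rel y x κ ∧ rel y x κ ≤ T i κ}

/-- Membership unfolded. [folklore] -/
theorem mem_anchoredUnion (y : Site P j) {m : ℕ} (T : Fin m → Fin P.d → ℤ) (x : Site P j) :
    x ∈ anchoredUnion y T ↔ ∃ i, ∀ κ, 0 ≤ rel y x κ ∧ rel y x κ ≤ T i κ := Iff.rfl

/-- **NO WRAP-AROUND FOR MEMBERS**: under the margin `2·T_i κ + 4 ≤ sitesPerDir`, a member `x` has `rel y (x + e_μ) = rel y x + e_μ`. [folklore] -/
theorem rel_shift_of_mem (y : Site P j) {m : ℕ} (T : Fin m → Fin P.d → ℤ) (hTN : ∀ i κ, 2 * T i κ + 4 ≤ (P.sitesPerDir j : ℤ)) {x : Site P j}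
    (hx : x ∈ anchoredUnion y T) (μ : Fin P.d) : rel y (x.shift μ) = rel y x + e μ := by
  obtain ⟨i, hi⟩ := hx
  exact rel_shift_of_le y x μ (by linarith [(hi μ).2, hTN i μ])

/-! ## §2 Every bond of the region is flat in the comb gauge from `y` -/

/-- **THE STENCIL GAUGE, SET FORM** (any `GaugeGroup`): plaquettes with lower corner and upper corner in `anchoredUnion y T` within `δ ≥ 0` of `1` ⟹ every bond with both endpoints in
`anchoredUnion y T` has `dist1((U^{axialT U y})(b)) ≤ S·δ`, `S` any common bound of the side sums `Σ_κ T_i κ`. [cite: Balaban1985Averaging, pp.24-25; Balaban1985RegularSpaces, Lemma 1 (1.25) p.79] -/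
theorem dist1_gaugeAct_axialT_le_of_mem {G : Type*} [GaugeGroup G] (U : GaugeField P j G) {δ : ℝ} (hδ : 0 ≤ δ) (y : Site P j) {m : ℕ} (T : Fin m → Fin P.d → ℤ)
    (hT0 : ∀ i κ, 0 ≤ T i κ) (hTN : ∀ i κ, 2 * T i κ + 4 ≤ (P.sitesPerDir j : ℤ)) {S : ℝ} (hS : ∀ i, ∑ κ, (T i κ : ℝ) ≤ S)
    (hU : ∀ q : Plaq P j, q.src ∈ anchoredUnion y T → (q.src.shift q.μ).shift q.ν ∈ anchoredUnion y T → dist1 (GaugeField.plaqHol U q) ≤ δ)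
    (b : PBond P j) (hs : b.src ∈ anchoredUnion y T) (ht : b.tgt ∈ anchoredUnion y T) :
    dist1 (GaugeField.gaugeAct (axialT U y) U b) ≤ S * δ := by
  -- the far endpoint decides the sub-box
  have hshift : rel y b.tgt = rel y b.src + e b.dir := rel_shift_of_mem y T hTN hs b.dir
  obtain ⟨i₀, h₀⟩ := hs
  obtain ⟨i, hi⟩ := ht
  have hv : ∀ κ, 0 ≤ rel y b.src κ := fun κ => (h₀ κ).1
  have hx : ∀ κ, (rel y b.src + e b.dir) κ ≤ T i κ := fun κ => by rw [← hshift]; exact (hi κ).2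
  -- the plaquette window of `…StencilGauge` from the set window
  have hW : ∀ q : Plaq P j, (∃ i, ∀ κ, 0 ≤ rel y q.src κ ∧ (rel y q.src + e q.μ + e q.ν) κ ≤ T i κ) → dist1 (GaugeField.plaqHol U q) ≤ δ := by
    rintro q ⟨i', hq⟩
    have he : ∀ κ, rel y q.src κ ≤ (rel y q.src + e q.μ + e q.ν) κ ∧ (rel y q.src + e q.μ) κ ≤ (rel y q.src + e q.μ + e q.ν) κ := fun κ => by
      simp only [Pi.add_apply, e_apply]; split_ifs <;> omega
    have hsrc : q.src ∈ anchoredUnion y T := ⟨i', fun κ => ⟨(hq κ).1, (he κ).1.trans (hq κ).2⟩⟩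
    have h1 : rel y (q.src.shift q.μ) = rel y q.src + e q.μ := rel_shift_of_mem y T hTN hsrc q.μ
    have hmid : q.src.shift q.μ ∈ anchoredUnion y T := ⟨i', fun κ => ⟨by rw [h1]; exact (hq κ).1.trans (by simp only [Pi.add_apply, e_apply]; split_ifs <;> omega),
      by rw [h1]; exact (he κ).2.trans (hq κ).2⟩⟩
    have h2 : rel y ((q.src.shift q.μ).shift q.ν) = rel y q.src + e q.μ + e q.ν := by rw [rel_shift_of_mem y T hTN hmid q.ν, h1]
    have hfar : (q.src.shift q.μ).shift q.ν ∈ anchoredUnion y T := ⟨i', fun κ => ⟨by rw [h2]; exact (hq κ).1.trans (he κ).1, by rw [h2]; exact (hq κ).2⟩⟩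
    exact hU q hsrc hfar
  have hb : b = ⟨b.src, b.dir⟩ := rfl
  have h := dist1_gaugeActT_axialT_le_sum_of_boxes U hδ y T hT0 hTN hW b.src b.dir hv i hx
  rw [hb]
  exact h.trans (mul_le_mul_of_nonneg_right (hS i) hδ)

/-! ## §3 The `SU(n)` reading and the `∃ σ` packaging -/

section SU

variable {n : Type*} [Fintype n] [DecidableEq n] [Nonempty n]

/-- **★★ THE STENCIL GAUGE IN THE CONSUMER'S CURRENCY**: for `U : SU(n)`-field, `N := anchoredUnion y T` and `σ := axialT U y`: `∀ b, b₋ ∈ N → b₊ ∈ N → ‖(U^σ)(b) − 1‖ ≤ S·δ`, from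
`dist1 ≤ δ` on the plaquettes with lower and upper corner in `N`. [cite: Balaban1985Averaging, (8) p.18, pp.24-25; Balaban1985RegularSpaces, Lemma 1 (1.25) p.79] -/
theorem norm_gaugeAct_axialT_sub_one_le_of_mem (U : GaugeField P j (Matrix.specialUnitaryGroup n ℂ)) {δ : ℝ} (hδ : 0 ≤ δ) (y : Site P j) {m : ℕ} (T : Fin m → Fin P.d → ℤ)
    (hT0 : ∀ i κ, 0 ≤ T i κ) (hTN : ∀ i κ, 2 * T i κ + 4 ≤ (P.sitesPerDir j : ℤ)) {S : ℝ} (hS : ∀ i, ∑ κ, (T i κ : ℝ) ≤ S)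
    (hU : ∀ q : Plaq P j, q.src ∈ anchoredUnion y T → (q.src.shift q.μ).shift q.ν ∈ anchoredUnion y T → dist1 (GaugeField.plaqHol U q) ≤ δ)
    (b : PBond P j) (hs : b.src ∈ anchoredUnion y T) (ht : b.tgt ∈ anchoredUnion y T) :
    ‖((GaugeField.gaugeAct (axialT U y) U b : Matrix.specialUnitaryGroup n ℂ) : Matrix n n ℂ) - 1‖ ≤ S * δ :=
  dist1_gaugeAct_axialT_le_of_mem U hδ y T hT0 hTN hS hU b hs ht

/-- **THE `∃ σ` PACKAGING**: an `S·δ`-flat gauge on the anchored union exists (namely the comb gauge from `y`). [cite: Balaban1985Averaging, (8) p.18, pp.24-25] -/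
theorem exists_flat_gauge_on_anchoredUnion (U : GaugeField P j (Matrix.specialUnitaryGroup n ℂ)) {δ : ℝ} (hδ : 0 ≤ δ) (y : Site P j) {m : ℕ} (T : Fin m → Fin P.d → ℤ)
    (hT0 : ∀ i κ, 0 ≤ T i κ) (hTN : ∀ i κ, 2 * T i κ + 4 ≤ (P.sitesPerDir j : ℤ)) {S : ℝ} (hS : ∀ i, ∑ κ, (T i κ : ℝ) ≤ S)
    (hU : ∀ q : Plaq P j, q.src ∈ anchoredUnion y T → (q.src.shift q.μ).shift q.ν ∈ anchoredUnion y T → dist1 (GaugeField.plaqHol U q) ≤ δ) :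
    ∃ σ : GaugeTransf P j (Matrix.specialUnitaryGroup n ℂ), ∀ b : PBond P j, b.src ∈ anchoredUnion y T → b.tgt ∈ anchoredUnion y T →
      ‖((GaugeField.gaugeAct σ U b : Matrix.specialUnitaryGroup n ℂ) : Matrix n n ℂ) - 1‖ ≤ S * δ :=
  ⟨axialT U y, fun b hs ht => norm_gaugeAct_axialT_sub_one_le_of_mem U hδ y T hT0 hTN hS hU b hs ht⟩

end SU

end Summit.QuantumFields.YangMills.Theorems.StencilGauge

end
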